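import Mathlib.Data.Real.Basic
import Mathlib.Tactic.Ring
import Mathlib.Tactic.Linarith
import Mathlib.Tactic.LinearCombination
import HarnessLib

/-!
# Conjecture N (hodge-weil ladder, GAPS G51b), format (5,3): THE EXACT TIME-PICTURE IDENTITIES (divided differences of the E-products at the F-lines)

Prover 2, generation 20 (note `run/shared/lean/b2b/hodge-weil/b2b-hweil-pv2-g20/SDP-G20.md` §5). In the time picture of pv2-g15/g17
(E-lines `U_e(y) = u_e + y A_e`, F-lines `w_g(y) = v_g + y B_g`, virtual alphabet `L(y) = {U_e(y)} ⊖ {w_g(y)}` with power sums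
`p_n(y) = Σ_e U_e(y)^n − Σ_g w_g(y)^n`), put `Π_g(y) := ∏_e (U_e(y) − w_g(y))` (the E-product seen from the F-root `g`). CENTRING ALONE gives,
for every time `y`, the exact identity (this file: the pair `(F₁,F₂)`; the pairs `(F₁,F₃)`, `(F₂,F₃)` follow by relabelling)
* `dividedDifference_identity₁₂`: `Π₁(y) − Π₂(y) = (w₂(y) − w₁(y))·(e₄(y) + e₃(y)·w₃(y))` with `e₃ = p₃/3`, `e₄ = (p₂² − 2p₄)/8` (Newton with
  `p₁ = 0`) — the all-`y` form of pv2-g13's companions and of pv2-g15's `Glam_eq_dd12`: the divided difference of `x ↦ ∏(x − U_e(y))` at two F-lines is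
  `e₄(L(y)) + e₃(L(y))·(third F-line)` (equivalently `∏_e(x − U_e(y)) ≡ −e₃x² + (e₄ + c₁e₃)x + …` modulo `∏_g(x − w_g(y))`, the all-`y` `lineId` of pv2-g17);
and with PURITY ((P1), (P2), (P4)) `e₃(y) = κy³/3` (`κ = ΣA³ − ΣB³`), so `(Π_g − Π_h)/(w_h − w_g) = Φ(y) + (κ/3)y³w_k(y)` with `Φ(y) = e₄(L(y))`
(`Φ₀ = −Q₄/12`, `Φ₂ = Q₂/2`; real N ⟺ `Φ₂ ≥ 6Φ₀`) — `dividedDifference_identity_pure₁₂`. Pure algebra (`subst` + `ring` / `linear_combination`); nothing here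
is a case of HC, a rung or a door edge; no statement of Markman's papers is used. New cell result ⇒ Summits/.
-/

set_option linter.dupNamespace false

namespace Summit.HodgeConjecture.HodgeConjecture.WeilClassTestFormatFiveThreeTimeIdentity

set_option maxRecDepth 100000 in
set_option maxHeartbeats 8000000 in
/-- **Divided-difference identity** for the pair `(F₁, F₂)` (centring only; all `y`): `Π₁(y) − Π₂(y) = (w₂(y) − w₁(y))·(e₄(y) + e₃(y)·w₃(y))`.
[new cell result; pv2-g20] -/
theorem dividedDifference_identity₁₂ (A₁ A₂ A₃ A₄ A₅ B₁ B₂ B₃ u₁ u₂ u₃ u₄ u₅ v₁ v₂ v₃ : ℝ)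
    (hA : A₁ + A₂ + A₃ + A₄ + A₅ = B₁ + B₂ + B₃) (hC : u₁ + u₂ + u₃ + u₄ + u₅ = v₁ + v₂ + v₃) (y : ℝ) :
    (((u₁ - v₁) + y * (A₁ - B₁)) * ((u₂ - v₁) + y * (A₂ - B₁)) * ((u₃ - v₁) + y * (A₃ - B₁)) * ((u₄ - v₁) + y * (A₄ - B₁)) * ((u₅ - v₁) + y * (A₅ - B₁)))
      - (((u₁ - v₂) + y * (A₁ - B₂)) * ((u₂ - v₂) + y * (A₂ - B₂)) * ((u₃ - v₂) + y * (A₃ - B₂)) * ((u₄ - v₂) + y * (A₄ - B₂)) * ((u₅ - v₂) + y * (A₅ - B₂)))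
      = ((v₂ + y * B₂) - (v₁ + y * B₁)) * (((1/8 : ℝ) * ((((u₁ + y * A₁) ^ 2 + (u₂ + y * A₂) ^ 2 + (u₃ + y * A₃) ^ 2 + (u₄ + y * A₄) ^ 2 + (u₅ + y * A₅) ^ 2) - ((v₁ + y * B₁) ^ 2 + (v₂ + y * B₂) ^ 2 + (v₃ + y * B₃) ^ 2)) ^ 2 - 2 * (((u₁ + y * A₁) ^ 4 + (u₂ + y * A₂) ^ 4 + (u₃ + y * A₃) ^ 4 + (u₄ + y * A₄) ^ 4 + (u₅ + y * A₅) ^ 4) - ((v₁ + y * B₁) ^ 4 + (v₂ + y * B₂) ^ 4 + (v₃ + y * B₃) ^ 4)))) + ((1/3 : ℝ) * (((u₁ + y * A₁) ^ 3 + (u₂ + y * A₂) ^ 3 + (u₃ + y * A₃) ^ 3 + (u₄ + y * A₄) ^ 3 + (u₅ + y * A₅) ^ 3) - ((v₁ + y * B₁) ^ 3 + (v₂ + y * B₂) ^ 3 + (v₃ + y * B₃) ^ 3))) * (v₃ + y * B₃)) := by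
  have hB : B₃ = A₁ + A₂ + A₃ + A₄ + A₅ - B₁ - B₂ := by linarith
  have hv : v₃ = u₁ + u₂ + u₃ + u₄ + u₅ - v₁ - v₂ := by linarith
  subst hB hv
  ring

set_option maxRecDepth 100000 in
set_option maxHeartbeats 8000000 in
/-- **Pure version** for the pair `(F₁, F₂)`: with (P1), (P2), (P4) the cubic `e₃(y)` collapses to `κy³/3`, `κ = ΣA³ − ΣB³`, so the divided difference of the
E-products at `F₁, F₂` is `Φ(y) + (κ/3)·y³·w₃(y)` with `Φ(y) = e₄(L(y)) = (p₂(y)² − 2p₄(y))/8`. [new cell result; pv2-g20] -/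
theorem dividedDifference_identity_pure₁₂ (A₁ A₂ A₃ A₄ A₅ B₁ B₂ B₃ u₁ u₂ u₃ u₄ u₅ v₁ v₂ v₃ : ℝ)
    (hA : A₁ + A₂ + A₃ + A₄ + A₅ = B₁ + B₂ + B₃) (hC : u₁ + u₂ + u₃ + u₄ + u₅ = v₁ + v₂ + v₃)
    (hP1 : (A₁ ^ 2 * u₁ + A₂ ^ 2 * u₂ + A₃ ^ 2 * u₃ + A₄ ^ 2 * u₄ + A₅ ^ 2 * u₅) - (B₁ ^ 2 * v₁ + B₂ ^ 2 * v₂ + B₃ ^ 2 * v₃) = 0)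
    (hP2 : (A₁ * u₁ ^ 2 + A₂ * u₂ ^ 2 + A₃ * u₃ ^ 2 + A₄ * u₄ ^ 2 + A₅ * u₅ ^ 2) - (B₁ * v₁ ^ 2 + B₂ * v₂ ^ 2 + B₃ * v₃ ^ 2) = 0)
    (hP4 : (u₁ ^ 3 + u₂ ^ 3 + u₃ ^ 3 + u₄ ^ 3 + u₅ ^ 3) - (v₁ ^ 3 + v₂ ^ 3 + v₃ ^ 3) = 0) (y : ℝ) :
    (((u₁ - v₁) + y * (A₁ - B₁)) * ((u₂ - v₁) + y * (A₂ - B₁)) * ((u₃ - v₁) + y * (A₃ - B₁)) * ((u₄ - v₁) + y * (A₄ - B₁)) * ((u₅ - v₁) + y * (A₅ - B₁)))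
      - (((u₁ - v₂) + y * (A₁ - B₂)) * ((u₂ - v₂) + y * (A₂ - B₂)) * ((u₃ - v₂) + y * (A₃ - B₂)) * ((u₄ - v₂) + y * (A₄ - B₂)) * ((u₅ - v₂) + y * (A₅ - B₂)))
      = ((v₂ + y * B₂) - (v₁ + y * B₁)) * (((1/8 : ℝ) * ((((u₁ + y * A₁) ^ 2 + (u₂ + y * A₂) ^ 2 + (u₃ + y * A₃) ^ 2 + (u₄ + y * A₄) ^ 2 + (u₅ + y * A₅) ^ 2) - ((v₁ + y * B₁) ^ 2 + (v₂ + y * B₂) ^ 2 + (v₃ + y * B₃) ^ 2)) ^ 2 - 2 * (((u₁ + y * A₁) ^ 4 + (u₂ + y * A₂) ^ 4 + (u₃ + y * A₃) ^ 4 + (u₄ + y * A₄) ^ 4 + (u₅ + y * A₅) ^ 4) - ((v₁ + y * B₁) ^ 4 + (v₂ + y * B₂) ^ 4 + (v₃ + y * B₃) ^ 4)))) + ((1/3 : ℝ) * ((A₁ ^ 3 + A₂ ^ 3 + A₃ ^ 3 + A₄ ^ 3 + A₅ ^ 3) - (B₁ ^ 3 + B₂ ^ 3 + B₃ ^ 3))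 * y ^ 3) * (v₃ + y * B₃)) := by
  have h := dividedDifference_identity₁₂ A₁ A₂ A₃ A₄ A₅ B₁ B₂ B₃ u₁ u₂ u₃ u₄ u₅ v₁ v₂ v₃ hA hC y
  have hp3 : (((u₁ + y * A₁) ^ 3 + (u₂ + y * A₂) ^ 3 + (u₃ + y * A₃) ^ 3 + (u₄ + y * A₄) ^ 3 + (u₅ + y * A₅) ^ 3) - ((v₁ + y * B₁) ^ 3 + (v₂ + y * B₂) ^ 3 + (v₃ + y * B₃) ^ 3)) = ((A₁ ^ 3 + A₂ ^ 3 + A₃ ^ 3 + A₄ ^ 3 + A₅ ^ 3) - (B₁ ^ 3 + B₂ ^ 3 + B₃ ^ 3)) * y ^ 3 := by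
    linear_combination hP4 + (3 * y) * hP2 + (3 * y ^ 2) * hP1
  linear_combination h + ((1/3 : ℝ) * (((v₂ + y * B₂) - (v₁ + y * B₁)) * (v₃ + y * B₃))) * hp3

end Summit.HodgeConjecture.HodgeConjecture.WeilClassTestFormatFiveThreeTimeIdentity
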